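import Mathlib.Analysis.Complex.Basic
import Mathlib.Analysis.SpecialFunctions.Complex.Log
import Mathlib.Algebra.QuadraticDiscriminant
import Literature.Topology.PlaneTopology.WindingNumber
import HarnessLib

/-!
# Complex linearisation of a leaf coordinate, and winding numbers under real-linear maps of `ℂ`

Bookkeeping for positivity of intersections against the leaves of a smooth (not holomorphic in
the parameter) family of `J`-holomorphic curves — the situation of the uniqueness clause of the
Hofer–Lizan–Sikorav local foliation statement
`Literature.Geometry.Symplectic.hls_localFoliation_embeddedSphere_trivialNormal`
(`JSphereLocalFoliation.lean`; C. Wendl, *Holomorphic Curves in Low Dimensions* (2018),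
Prop. 2.53 with Thm. 2.49). There a leaf coordinate `A` (the leaf parameter as a function on
the foliated open set) is a smooth submersion whose differential `L = dA_y : T_y X → ℂ` kills
the `J`-invariant tangent plane of the leaf through `y`, but is NOT complex linear; the local
index statement `positivityOfIntersections_leafCoordinate` (`PositivityOfIntersectionsLocal.lean`,
Wendl §2.2.2; McDuff 1991, Thm. 1.1) wants a leaf coordinate whose differential at the
intersection point IS complex linear. The remedy (McDuff–Salamon, *J-holomorphic curves and
symplectic topology* (2012), App. E, proof of Thm. E.1.2: "choose coordinates in which the
second curve is an axis and `J = J₀` along it"; here only at one point) is to post-compose the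
coordinate with a real-linear automorphism `M` of `ℂ`, which changes winding numbers by the sign
of `det M`. Everything here is proved; no definitions, no named facts.

* Winding numbers (`Literature.Topology.PlaneTopology.wind`): `wind_conj` — `wind (f̄) = -wind f`;
  `wind_mul_add_mul_conj_of_norm_lt` / `…_lt'` — **`wind (α f + β f̄) = wind f` if `|β| < |α|`,
  `= -wind f` if `|α| < |β|`** (every real-linear map of `ℂ` is `x ↦ α x + β x̄`, orientation
  preserving iff `|β| < |α|`); `bijective_mul_add_mul_conj` — such a map is bijective when
  `|α| ≠ |β|`.
* A real-linear functional `L : V → ℂ` with `J`-invariant kernel, `J² = -1` (linear algebra of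
  `T_y X → T_y X / T_y(leaf) ≅ ℂ`): `im_mul_conj_ne_zero` — for `L v ≠ 0`, `L v` and `L (J v)`
  are `ℝ`-independent (`Q v := Im (L(Jv) · conj (L v)) ≠ 0`); `im_mul_conj_pos_iff` — **the
  sign of `Q` is the same at all `v ∉ ker L`** (the orientation sign of `L` relative to `J`,
  proved by a root-of-a-quadratic argument, no dimension hypothesis);
  `exists_complexLinearisation` — **for `L` onto, there are `α, β` with `|α| ≠ |β|` such that
  `M x = α x + β x̄` makes `M ∘ L` complex linear (`M (L (J v)) = i M (L v)`), with `|β| < |α|`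
  iff the orientation sign is `+`.**

## References

* D. McDuff, D. Salamon, *J-holomorphic curves and symplectic topology*, 2nd ed., AMS Coll.
  Publ. 52 (2012), App. E (proof of Thm. E.1.2). [McDuffSalamon2012]
* C. Wendl, *Holomorphic Curves in Low Dimensions*, LNM 2216 (2018), §2.2.2, Prop. 2.53.
  [Wendl2018]
-/

noncomputable section

open Set Function Complex Literature.Topology.PlaneTopology
open scoped ComplexConjugate

namespace Literature.Geometry.Symplectic

/-! ### Winding numbers of conjugated and real-linearly transformed loops -/

section Wind

variable {f : ℝ → ℂ}

/-- A continuous positive real loop has winding number `0` (it stays within distance `B` of the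
constant loop `B`, `B` the maximum of its values). [folklore] -/
theorem wind_ofReal_eq_zero {g : ℝ → ℝ} (hg : ContinuousOn g (Icc 0 1))
    (hpos : ∀ t ∈ Icc (0 : ℝ) 1, 0 < g t) (h01 : g 0 = g 1) :
    wind (fun t => (g t : ℂ)) = 0 := by
  obtain ⟨B, hBmem, hB⟩ := (isCompact_Icc : IsCompact (Icc (0 : ℝ) 1)).exists_isMaxOn
    ⟨0, le_rfl, zero_le_one⟩ hg
  have hBpos : 0 < g B := hpos B hBmem
  have h := wind_eq_of_norm_sub_lt (f := fun t => (g t : ℂ)) (g := fun _ => ((g B : ℝ) : ℂ))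
    (continuous_ofReal.comp_continuousOn hg) (by simp [h01])
    (IsNonvanishingLoop.const (by exact_mod_cast hBpos.ne')) (fun t ht => by
      have h1 : g t ≤ g B := hB ht
      have h2 : 0 < g t := hpos t ht
      rw [← ofReal_sub, norm_real, norm_real, Real.norm_eq_abs, Real.norm_eq_abs,
        abs_of_pos hBpos, abs_lt]
      constructor <;> linarith)
  rw [h, wind_const]

/-- **The conjugate loop winds the other way**: `wind (conj ∘ f) = - wind f`
(`conj z = |z|² z⁻¹`, and the positive loop `|f|²` has winding number `0`). [folklore] -/
theorem wind_conj (hf : IsNonvanishingLoop f) : wind (fun t => conj (f t)) = -wind f := by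
  have hc : ContinuousOn (fun t => Complex.normSq (f t)) (Icc 0 1) :=
    Complex.continuous_normSq.comp_continuousOn hf.continuousOn
  have hns : IsNonvanishingLoop fun t => ((Complex.normSq (f t) : ℝ) : ℂ) :=
    ⟨continuous_ofReal.comp_continuousOn hc,
      fun t ht => by exact_mod_cast (Complex.normSq_pos.2 (hf.ne_zero t ht)).ne',
      by simp [hf.eq_endpoints]⟩
  have h0 : wind (fun t => ((Complex.normSq (f t) : ℝ) : ℂ)) = 0 :=
    wind_ofReal_eq_zero hc (fun t ht => Complex.normSq_pos.2 (hf.ne_zero t ht))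
      (by simp [hf.eq_endpoints])
  have heq : EqOn (fun t => conj (f t))
      (fun t => ((Complex.normSq (f t) : ℝ) : ℂ) * (f t)⁻¹) (Icc 0 1) := fun t ht => by
    have hne := hf.ne_zero t ht
    simp only
    rw [← Complex.mul_conj, mul_right_comm, mul_inv_cancel₀ hne, one_mul]
  rw [wind_congr heq, wind_mul hns hf.inv, wind_inv hf, h0, zero_add]

/-- **A real-linear map `x ↦ α x + β x̄` with `|β| < |α|` preserves winding numbers**:
`α f + β f̄ = (α f) · (1 + (β/α) f̄/f)` and the second factor stays within distance `1` of `1`.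
[folklore] -/
theorem wind_mul_add_mul_conj_of_norm_lt (hf : IsNonvanishingLoop f) {α β : ℂ}
    (h : ‖β‖ < ‖α‖) : wind (fun t => α * f t + β * conj (f t)) = wind f := by
  have hα : α ≠ 0 := by
    rintro rfl
    rw [norm_zero] at h
    exact absurd h (not_lt.2 (norm_nonneg β))
  set k : ℝ → ℂ := fun t => 1 + β / α * (conj (f t) / f t) with hk
  have hkc : ContinuousOn k (Icc 0 1) :=
    continuousOn_const.add (continuousOn_const.mul
      ((Complex.continuous_conj.comp_continuousOn hf.continuousOn).div hf.continuousOn hf.ne_zero))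
  have hk01 : k 0 = k 1 := by simp [hk, hf.eq_endpoints]
  have hkn : ∀ t ∈ Icc (0 : ℝ) 1, ‖k t - 1‖ < ‖(1 : ℂ)‖ := fun t ht => by
    have hne := hf.ne_zero t ht
    simp only [hk, add_sub_cancel_left, norm_mul, norm_div, Complex.norm_conj, norm_one]
    rw [div_self (norm_ne_zero_iff.2 hne), mul_one, div_lt_one (norm_pos_iff.2 hα)]
    exact h
  have hkw : wind k = 0 := by
    rw [wind_eq_of_norm_sub_lt hkc hk01 (IsNonvanishingLoop.const one_ne_zero) hkn, wind_const]
  have hkl : IsNonvanishingLoop k := ⟨hkc, fun t ht h0 => by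
    have := hkn t ht
    rw [h0, zero_sub, norm_neg, norm_one] at this
    exact lt_irrefl _ this, hk01⟩
  have hαf : IsNonvanishingLoop fun t => α * f t := (IsNonvanishingLoop.const hα).mul hf
  have heq : EqOn (fun t => α * f t + β * conj (f t)) (fun t => α * f t * k t) (Icc 0 1) :=
    fun t ht => by
      have hne := hf.ne_zero t ht
      simp only [hk]
      field_simp
  rw [wind_congr heq, wind_mul hαf hkl, hkw, add_zero, wind_mul (IsNonvanishingLoop.const hα) hf,
    wind_const, zero_add]

/-- **A real-linear map `x ↦ α x + β x̄` with `|α| < |β|` reverses winding numbers.** [folklore] -/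
theorem wind_mul_add_mul_conj_of_norm_lt' (hf : IsNonvanishingLoop f) {α β : ℂ}
    (h : ‖α‖ < ‖β‖) : wind (fun t => α * f t + β * conj (f t)) = -wind f := by
  have hf' : IsNonvanishingLoop fun t => conj (f t) :=
    ⟨Complex.continuous_conj.comp_continuousOn hf.continuousOn,
      fun t ht => by simpa using hf.ne_zero t ht, by simp [hf.eq_endpoints]⟩
  have := wind_mul_add_mul_conj_of_norm_lt hf' (α := β) (β := α) h
  simp only [Complex.conj_conj] at this
  rw [← wind_conj hf, ← this]
  congr 1
  funext t
  ring

/-- `x ↦ α x + β x̄` is bijective when `|α| ≠ |β|` (inverse `y ↦ (ᾱ y - β ȳ)/(|α|² - |β|²)`).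
[folklore] -/
theorem bijective_mul_add_mul_conj {α β : ℂ} (h : ‖α‖ ≠ ‖β‖) :
    Bijective fun x : ℂ => α * x + β * conj x := by
  have hD : ((Complex.normSq α - Complex.normSq β : ℝ) : ℂ) ≠ 0 := by
    rw [Ne, ofReal_eq_zero, sub_eq_zero, Complex.normSq_eq_norm_sq, Complex.normSq_eq_norm_sq]
    intro h'
    exact h (by nlinarith [norm_nonneg α, norm_nonneg β, h'])
  set D : ℂ := ((Complex.normSq α - Complex.normSq β : ℝ) : ℂ) with hDdef
  have hDα : conj α * α - β * conj β = D := by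
    rw [hDdef, ofReal_sub, ← Complex.mul_conj, ← Complex.mul_conj]
    ring
  set g : ℂ → ℂ := fun y => (conj α * y - β * conj y) / D with hg
  have hleft : ∀ x, g (α * x + β * conj x) = x := fun x => by
    simp only [hg, map_add, map_mul, Complex.conj_conj]
    rw [div_eq_iff hD, ← hDα]
    ring
  have hright : ∀ y, α * g y + β * conj (g y) = y := fun y => by
    simp only [hg, map_div₀, map_sub, map_mul, Complex.conj_conj]
    have hDc : conj D = D := by rw [hDdef, Complex.conj_ofReal]
    rw [hDc]
    field_simp
    rw [← hDα]
    ring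
  exact ⟨fun x y hxy => by simpa [hleft] using congrArg g hxy, fun y => ⟨g y, hright y⟩⟩

end Wind

/-! ### A real functional with `J`-invariant kernel: its sign and its complex linearisation -/

section Functional

variable {V : Type*} [AddCommGroup V] [Module ℝ V] (J : V →ₗ[ℝ] V) (L : V →ₗ[ℝ] ℂ)

/-- **Non-degeneracy.** If `J² = -1` and `ker L` is `J`-invariant, then for every `v` with
`L v ≠ 0` the complex numbers `L v`, `L (J v)` are `ℝ`-independent: `Im (L(Jv) · conj (L v)) ≠ 0`
(were `L (J v) = λ L v` with `λ` real, `Jv - λ v ∈ ker L`, hence `-v - λ J v ∈ ker L`, hence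
`(1 + λ²) L v = 0`). [folklore] -/
theorem im_mul_conj_ne_zero (hJ : ∀ v, J (J v) = -v) (hker : ∀ v, L v = 0 → L (J v) = 0)
    {v : V} (hv : L v ≠ 0) : (L (J v) * conj (L v)).im ≠ 0 := by
  intro him
  set c : ℂ := L v with hc
  set d : ℂ := L (J v) with hd
  set r : ℝ := (d * conj c).re with hr
  have hdc : d * conj c = (r : ℂ) := Complex.ext (by simp [hr]) (by simpa using him)
  have hnc : (Complex.normSq c : ℂ) ≠ 0 := by exact_mod_cast (Complex.normSq_pos.2 hv).ne'
  set lam : ℝ := r / Complex.normSq c with hlam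
  have hdl : d = (lam : ℂ) * c := by
    have h1 : d * (Complex.normSq c : ℂ) = (r : ℂ) * c := by
      calc d * (Complex.normSq c : ℂ) = d * (c * conj c) := by rw [Complex.mul_conj]
        _ = d * conj c * c := by ring
        _ = (r : ℂ) * c := by rw [hdc]
    rw [hlam, ofReal_div, div_mul_eq_mul_div, eq_div_iff hnc, ← h1]
  -- `Jv - λ v ∈ ker L`
  have hk : L (J v - lam • v) = 0 := by
    rw [map_sub, map_smul, ← hd, ← hc, hdl, Complex.real_smul, sub_self]
  have hk' := hker _ hk
  rw [map_sub, map_smul, hJ, map_sub, map_neg, map_smul, ← hc, ← hd, hdl, Complex.real_smul] at hk'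
  have : c * (1 + (lam : ℂ) * lam) = 0 := by linear_combination -hk'
  rcases mul_eq_zero.1 this with h0 | h0
  · exact hv h0
  · have : (1 + lam * lam : ℝ) = 0 := by exact_mod_cast h0
    nlinarith [mul_self_nonneg lam]

/-- The quadratic form `Q v = Im (L(Jv) · conj (L v))` along a line. [folklore] -/
theorem im_mul_conj_add_smul (v w : V) (t : ℝ) :
    (L (J (v + t • w)) * conj (L (v + t • w))).im =
      (L (J v) * conj (L v)).im + t * (L (J v) * conj (L w) + L (J w) * conj (L v)).im +
        t * t * (L (J w) * conj (L w)).im := by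
  simp only [map_add, map_smul, Complex.real_smul, map_mul, Complex.conj_ofReal]
  simp only [Complex.add_im, Complex.mul_im, Complex.mul_re, Complex.ofReal_re, Complex.ofReal_im,
    Complex.add_re]
  ring

/-- `Q (J v) = Q v`. [folklore] -/
theorem im_mul_conj_J (hJ : ∀ v, J (J v) = -v) (v : V) :
    (L (J (J v)) * conj (L (J v))).im = (L (J v) * conj (L v)).im := by
  rw [hJ, map_neg]
  have : (-L v * conj (L (J v))) = -conj (L (J v) * conj (L v)) := by
    rw [map_mul, Complex.conj_conj]
    ring
  rw [this, Complex.neg_im, Complex.conj_im, neg_neg]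

/-- **Sign consistency.** With `J² = -1` and `ker L` `J`-invariant, the sign of
`Im (L(Jv) · conj (L v))` does not take both values: if it were positive at `v` and negative at
`w`, the quadratics `t ↦ Q(v + t w)` and `t ↦ Q(v + t Jw)` would have roots, forcing
`L v ∈ ℝ L w ∩ ℝ L(Jw)` and then `Q w = 0`. [folklore] -/
theorem not_im_mul_conj_pos_neg (hJ : ∀ v, J (J v) = -v) (hker : ∀ v, L v = 0 → L (J v) = 0)
    (v w : V) : ¬ (0 < (L (J v) * conj (L v)).im ∧ (L (J w) * conj (L w)).im < 0) := by
  rintro ⟨hv, hw⟩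
  -- abbreviations
  set Qv : ℝ := (L (J v) * conj (L v)).im with hQv
  set Qw : ℝ := (L (J w) * conj (L w)).im with hQw
  have hLv : L v ≠ 0 := fun h0 => by
    rw [hQv, h0, map_zero, mul_zero, Complex.zero_im] at hv
    exact lt_irrefl _ hv
  -- a quadratic with `c > 0 > a` has a real root
  have hroot : ∀ (a b : ℝ), a < 0 → ∃ t : ℝ, Qv + t * b + t * t * a = 0 := fun a b ha => by
    have hdisc : 0 ≤ discrim a b Qv := by
      rw [discrim]
      nlinarith
    obtain ⟨t, ht⟩ := exists_quadratic_eq_zero ha.ne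
      ⟨Real.sqrt (discrim a b Qv), (Real.mul_self_sqrt hdisc).symm⟩
    exact ⟨t, by linear_combination ht⟩
  -- root of `Q(v + t w)`
  obtain ⟨t₀, ht₀⟩ := hroot Qw ((L (J v) * conj (L w) + L (J w) * conj (L v)).im) hw
  have hz₀ : (L (J (v + t₀ • w)) * conj (L (v + t₀ • w))).im = 0 := by
    rw [im_mul_conj_add_smul]
    linear_combination ht₀
  have hL₀ : L (v + t₀ • w) = 0 := by
    by_contra hne
    exact im_mul_conj_ne_zero J L hJ hker hne hz₀
  -- root of `Q(v + t (J w))`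
  have hQJw : (L (J (J w)) * conj (L (J w))).im = Qw := im_mul_conj_J J L hJ w
  obtain ⟨t₁, ht₁⟩ := hroot Qw ((L (J v) * conj (L (J w)) + L (J (J w)) * conj (L v)).im)
    (by rw [← hQJw] at hw; exact hQJw ▸ hw)
  have hz₁ : (L (J (v + t₁ • J w)) * conj (L (v + t₁ • J w))).im = 0 := by
    rw [im_mul_conj_add_smul, hQJw]
    linear_combination ht₁
  have hL₁ : L (v + t₁ • J w) = 0 := by
    by_contra hne
    exact im_mul_conj_ne_zero J L hJ hker hne hz₁
  rw [map_add, map_smul, Complex.real_smul] at hL₀ hL₁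
  -- `L v = -t₀ L w = -t₁ L (J w)`, `t₀ ≠ 0`
  have ht₀ne : t₀ ≠ 0 := by
    rintro rfl
    simp only [ofReal_zero, zero_mul, add_zero] at hL₀
    exact hLv hL₀
  have hLw : L w = ((t₁ / t₀ : ℝ) : ℂ) * L (J w) := by
    rw [ofReal_div, div_mul_eq_mul_div, eq_div_iff (ofReal_ne_zero.2 ht₀ne)]
    linear_combination hL₀ - hL₁
  have : Qw = 0 := by
    rw [hQw, hLw, map_mul, Complex.conj_ofReal, mul_left_comm, Complex.im_ofReal_mul,
      Complex.mul_conj, Complex.ofReal_im, mul_zero]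
  rw [this] at hw
  exact lt_irrefl _ hw

/-- **Sign consistency, `iff` form**: for `v, w` off the kernel the signs of `Q v`, `Q w` agree.
[folklore] -/
theorem im_mul_conj_pos_iff (hJ : ∀ v, J (J v) = -v) (hker : ∀ v, L v = 0 → L (J v) = 0)
    {v w : V} (hv : L v ≠ 0) (hw : L w ≠ 0) :
    0 < (L (J v) * conj (L v)).im ↔ 0 < (L (J w) * conj (L w)).im := by
  have hv' := im_mul_conj_ne_zero J L hJ hker hv
  have hw' := im_mul_conj_ne_zero J L hJ hker hw
  constructor
  · intro h
    rcases lt_or_gt_of_ne hw' with h' | h'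
    · exact absurd ⟨h, h'⟩ (not_im_mul_conj_pos_neg J L hJ hker v w)
    · exact h'
  · intro h
    rcases lt_or_gt_of_ne hv' with h' | h'
    · exact absurd ⟨h, h'⟩ (not_im_mul_conj_pos_neg J L hJ hker w v)
    · exact h'

/-- **Complex linearisation of a surjective real functional with `J`-invariant kernel.** With
`J² = -1`, `ker L` `J`-invariant and `L` onto `ℂ`, there are `α, β ∈ ℂ` with `|α| ≠ |β|` such
that `M x = α x + β x̄` (a real-linear AUTOMORPHISM of `ℂ`) makes `M ∘ L` complex linear,
`M (L (J v)) = i · M (L v)`; and `M` preserves orientation (`|β| < |α|`) exactly when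
`Im (L(Jv) · conj (L v)) > 0` off the kernel. (Take `ν` with `L ν = 1`, `g = L (J ν)`;
`M` is the real-linear map with `M 1 = 1`, `M g = i`.) [folklore] -/
theorem exists_complexLinearisation (hJ : ∀ v, J (J v) = -v)
    (hker : ∀ v, L v = 0 → L (J v) = 0) (hsurj : Surjective L) :
    ∃ α β : ℂ, ‖α‖ ≠ ‖β‖ ∧
      (∀ v, α * L (J v) + β * conj (L (J v)) = I * (α * L v + β * conj (L v))) ∧
      (∀ v, L v ≠ 0 → (‖β‖ < ‖α‖ ↔ 0 < (L (J v) * conj (L v)).im)) ∧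
      (∀ v, L v ≠ 0 → (‖α‖ < ‖β‖ ↔ (L (J v) * conj (L v)).im < 0)) := by
  obtain ⟨ν, hν⟩ := hsurj 1
  set g : ℂ := L (J ν) with hg
  have hν0 : L ν ≠ 0 := by rw [hν]; exact one_ne_zero
  have hb : g.im ≠ 0 := by
    have := im_mul_conj_ne_zero J L hJ hker hν0
    rwa [hν, map_one, mul_one] at this
  set a : ℝ := g.re with ha
  set b : ℝ := g.im with hbdef
  have hgab : g = (a : ℂ) + (b : ℂ) * I := (re_add_im g).symm
  set α : ℂ := (((b + 1 : ℝ) : ℂ) + (a : ℂ) * I) / (2 * (b : ℂ)) with hαdef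
  set β : ℂ := (((b - 1 : ℝ) : ℂ) - (a : ℂ) * I) / (2 * (b : ℂ)) with hβdef
  have h2b : (2 * (b : ℂ)) ≠ 0 := mul_ne_zero two_ne_zero (ofReal_ne_zero.2 hb)
  have hM1 : α + β = 1 := by
    rw [hαdef, hβdef, ← add_div, div_eq_iff h2b]
    push_cast
    ring
  have hconj : conj g = (a : ℂ) - (b : ℂ) * I := by
    rw [hgab]
    simp only [map_add, map_mul, Complex.conj_ofReal, Complex.conj_I]
    ring
  have hnum : ((((b + 1 : ℝ) : ℂ) + (a : ℂ) * I) * ((a : ℂ) + (b : ℂ) * I) +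
      ((((b - 1 : ℝ) : ℂ) - (a : ℂ) * I)) * ((a : ℂ) - (b : ℂ) * I)) = 2 * (b : ℂ) * I := by
    push_cast
    ring_nf
    rw [Complex.I_sq]
    ring
  have hMg : α * g + β * conj g = I := by
    rw [hconj, hgab, hαdef, hβdef, div_mul_eq_mul_div, div_mul_eq_mul_div, ← add_div, hnum]
    exact mul_div_cancel_left₀ I h2b
  -- norms: `|α|² - |β|² = 1/b`
  have hn2b : Complex.normSq (2 * (b : ℂ)) = 4 * b ^ 2 := by
    rw [Complex.normSq_apply]
    simp
    ring
  have hnα : Complex.normSq (((b + 1 : ℝ) : ℂ) + (a : ℂ) * I) = (b + 1) ^ 2 + a ^ 2 := by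
    rw [Complex.normSq_apply]
    simp
    ring
  have hnβ : Complex.normSq (((b - 1 : ℝ) : ℂ) - (a : ℂ) * I) = (b - 1) ^ 2 + a ^ 2 := by
    rw [Complex.normSq_apply]
    simp
    ring
  have hnormsq : Complex.normSq α - Complex.normSq β = 1 / b := by
    rw [hαdef, hβdef, Complex.normSq_div, Complex.normSq_div, hnα, hnβ, hn2b]
    field_simp
    ring
  have hneq : ‖α‖ ≠ ‖β‖ := fun h => by
    have : Complex.normSq α = Complex.normSq β := by
      rw [Complex.normSq_eq_norm_sq, Complex.normSq_eq_norm_sq, h]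
    rw [this, sub_self] at hnormsq
    exact hb (by field_simp at hnormsq; linarith [hnormsq])
  have hlt_iff : ‖β‖ < ‖α‖ ↔ 0 < b := by
    rw [← sq_lt_sq₀ (norm_nonneg _) (norm_nonneg _), ← Complex.normSq_eq_norm_sq,
      ← Complex.normSq_eq_norm_sq, ← sub_pos, hnormsq, one_div, inv_pos]
  have hgt_iff : ‖α‖ < ‖β‖ ↔ b < 0 := by
    rw [← sq_lt_sq₀ (norm_nonneg _) (norm_nonneg _), ← Complex.normSq_eq_norm_sq,
      ← Complex.normSq_eq_norm_sq, ← sub_neg, hnormsq, one_div, inv_lt_zero]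
  have hQν : (L (J ν) * conj (L ν)).im = b := by rw [hν, map_one, mul_one]
  refine ⟨α, β, hneq, fun v => ?_, fun v hv => ?_, fun v hv => ?_⟩
  · -- complex linearity: decompose `L v = p + q g`
    set q : ℝ := (L v).im / b with hq
    set p : ℝ := (L v).re - q * a with hp
    have hLv : L v = (p : ℂ) + (q : ℂ) * g := by
      apply Complex.ext
      · simp [hp, hgab]
      · simp only [Complex.add_im, Complex.ofReal_im, Complex.mul_im, Complex.ofReal_re, zero_add,
          hgab, Complex.add_re, Complex.mul_re, Complex.I_re, Complex.I_im, Complex.ofReal_im]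
        rw [hq]
        field_simp
        ring
    -- `k = v - p ν - q Jν ∈ ker L`, hence `J k ∈ ker L`
    have hk : L (v - p • ν - q • J ν) = 0 := by
      rw [map_sub, map_sub, map_smul, map_smul, hν, ← hg, hLv, Complex.real_smul,
        Complex.real_smul, mul_one]
      ring
    have hk' := hker _ hk
    rw [map_sub, map_sub, map_smul, map_smul, hJ, map_sub, map_sub, map_smul, map_neg,
      map_smul, ← hg, hν, Complex.real_smul, Complex.real_smul] at hk'
    have hLJv : L (J v) = (p : ℂ) * g - (q : ℂ) := by linear_combination hk'
    rw [hLJv, hLv]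
    simp only [map_sub, map_add, map_mul, Complex.conj_ofReal]
    have e1 : α * ((p : ℂ) * g - q) + β * ((p : ℂ) * conj g - q) =
        (p : ℂ) * (α * g + β * conj g) - (q : ℂ) * (α + β) := by ring
    have e2 : I * (α * ((p : ℂ) + q * g) + β * ((p : ℂ) + q * conj g)) =
        I * ((p : ℂ) * (α + β) + (q : ℂ) * (α * g + β * conj g)) := by ring
    rw [e1, e2, hMg, hM1]
    ring_nf
    rw [Complex.I_sq]
    ring
  · rw [hlt_iff, ← hQν]
    exact (im_mul_conj_pos_iff J L hJ hker hν0 hv)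
  · rw [hgt_iff, ← hQν]
    have h1 := im_mul_conj_pos_iff J L hJ hker hν0 hv
    have h2 := im_mul_conj_ne_zero J L hJ hker hν0
    have h3 := im_mul_conj_ne_zero J L hJ hker hv
    constructor
    · intro h
      rcases lt_or_gt_of_ne h3 with h' | h'
      · exact h'
      · exact absurd (h1.2 h') (not_lt.2 h.le)
    · intro h
      rcases lt_or_gt_of_ne h2 with h' | h'
      · exact h'
      · exact absurd (h1.1 h') (not_lt.2 h.le)

end Functional

end Literature.Geometry.Symplectic

end
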